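import Summits.Ventures.PercRepro2.CaseOneA2EdgeQId

/-!
# The T-world threshold forms `(ii-T)`, `(i-T)` and their facts along an `a₂a₃`-edge
(blind cell PercRepro2, p1 g30)

The T-world is `T = Q ∩ {a₃ ∈ C₂}` (the case-2 world of the rung); its `o`-pair is
`(Dto, Dt) = (P(T, o ∈ U), P(T))`, threshold `γ_T = P(o ∈ U ∣ Q, a₃ ∈ C₂)`. **`ZSplitIIT`** /
**`ZSplitIT`** are the `(ii)` / `(i)` forms at that pair — a definition only (census-true: 906 + 6
random instances, proofs/P1-G30.md §2′′). They are what the `a₂`-edge rule for the Q-threshold forms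
needs: with `e₂ = {a₂, a₃}` forced open, `Q` becomes `Q ∩ {a₃ ∉ C₁} = PD ⊔ T`, so the forced-open
Q-pair DOMINATES the sum of the PD pair and the T-pair of `G − e₂` (**`Dqo_update_one_ge`**,
`prob_Q_update_one_eq_Dpd_add`), and the `(ii)` form at the forced-open pair is at least the sum of
the forms at the PD pair and at the T-pair (`CaseOneA2EdgeT.lean`). Also: the T-pair is the
`r`-mixture of its forced-closed version and the forced-open Q-pair (**`Dt_pin`**, **`Dto_pin`**,
`Dt_update_one`, `Dto_update_one`), and the T-odds lemma **`odds_t`**: `γ_T ≥ P(o ∈ C₂ ∣ Q, a₃ ∈ C₁)`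
(BHK 1.4, BHK 1.3 and `{o ∈ C₂} ⊆ {o ∈ U}`). Own code; standard axioms.
-/

namespace Summit.Ventures.PercRepro2

namespace CaseOne

/-! ## The T-pair and the forms -/

section TDefs
variable {V : Type*} {E : Type*} [Fintype E] [DecidableEq E] {R : Type*} [CommRing R]

/-- `P(T) = P(Q, a₃ ∈ C₂)`, the mass of the case-2 world. -/
noncomputable def Dt (p : E → R) (ends : E → Sym2 V) (a₁ a₂ a₃ : V) : R :=
  prob p (connEvent ends a₂ a₃ ∩ (connEvent ends a₁ a₂)ᶜ)

/-- `P(T, o ∈ U) = P(Q, a₃ ∈ C₂, o ∈ C₁ ∪ C₂)`. -/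
noncomputable def Dto (p : E → R) (ends : E → Sym2 V) (o a₁ a₂ a₃ : V) : R :=
  prob p ((connEvent ends a₁ o ∪ connEvent ends a₂ o) ∩ connEvent ends a₂ a₃ ∩
    (connEvent ends a₁ a₂)ᶜ)

end TDefs

section TProps
variable {V : Type*} {E : Type*} [Fintype E] [DecidableEq E] {R : Type*} [CommRing R] [LinearOrder R]

/-- **`(ii)` at the T-world threshold** `γ_T = P(o ∈ U ∣ Q, a₃ ∈ C₂)`, cleared. A definition only. -/
def ZSplitIIT (p : E → R) (ends : E → Sym2 V) (o a₁ a₂ a₃ b : V) : Prop :=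
  0 ≤ iiExprT p ends o a₁ a₂ a₃ b (Dto p ends o a₁ a₂ a₃) (Dt p ends a₁ a₂ a₃)

/-- **`(i)` at the T-world threshold**, cleared. A definition only. -/
def ZSplitIT (p : E → R) (ends : E → Sym2 V) (o a₁ a₂ a₃ b : V) : Prop :=
  0 ≤ iExprT p ends o a₁ a₂ a₃ b (Dto p ends o a₁ a₂ a₃) (Dt p ends a₁ a₂ a₃)

end TProps

/-! ## The T-pair along an `a₂a₃`-edge -/

section TPin
variable {V : Type*} {E : Type*} [Fintype E] [DecidableEq E] {R : Type*} [CommRing R]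
variable {ends : E → Sym2 V} {a₁ a₂ a₃ : V} {e₂ : E}

/-- `P(T)` is the `r`-mixture of its forced-closed and forced-open versions. -/
lemma Dt_pin (p : E → R) (e₂ : E) :
    Dt p ends a₁ a₂ a₃ = p e₂ * Dt (Function.update p e₂ 1) ends a₁ a₂ a₃ +
      (1 - p e₂) * Dt (Function.update p e₂ 0) ends a₁ a₂ a₃ := by
  unfold Dt
  exact prob_eq_pin p _ e₂

/-- `P(T, o ∈ U)` is the `r`-mixture of its forced-closed and forced-open versions. -/
lemma Dto_pin (p : E → R) (e₂ : E) (o : V) :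
    Dto p ends o a₁ a₂ a₃ = p e₂ * Dto (Function.update p e₂ 1) ends o a₁ a₂ a₃ +
      (1 - p e₂) * Dto (Function.update p e₂ 0) ends o a₁ a₂ a₃ := by
  unfold Dto
  exact prob_eq_pin p _ e₂

omit [Fintype E] in
/-- With `e₂ = {a₂, a₃}` forced open, `a₂ ↔ a₃`. -/
lemma conn_a2_a3_update_true (he : ends e₂ = s(a₂, a₃)) (ω : Config E) :
    Conn ends (Function.update ω e₂ true) a₂ a₃ :=
  conn_of_openAdj ⟨e₂, by simp, he⟩

/-- With `e₂` forced open the T-world is the whole of `Q`: `Dt p₁ = P₁(Q)`. -/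
lemma Dt_update_one (p : E → R) (he : ends e₂ = s(a₂, a₃)) :
    Dt (Function.update p e₂ 1) ends a₁ a₂ a₃ =
      prob (Function.update p e₂ 1) (connEvent ends a₁ a₂)ᶜ := by
  unfold Dt
  rw [prob_update_one_eq_preimage', prob_update_one_eq_preimage']
  congr 1
  ext ω
  simp only [Set.mem_preimage, Set.mem_inter_iff, Set.mem_compl_iff, mem_connEvent]
  exact ⟨fun h => h.2, fun h => ⟨conn_a2_a3_update_true he ω, h⟩⟩

/-- With `e₂` forced open, `Dto p₁ = Dqo p₁`. -/
lemma Dto_update_one (p : E → R) (he : ends e₂ = s(a₂, a₃)) (o : V) :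
    Dto (Function.update p e₂ 1) ends o a₁ a₂ a₃ = Dqo (Function.update p e₂ 1) ends o a₁ a₂ :=
  by
  unfold Dto Dqo
  rw [prob_update_one_eq_preimage', prob_update_one_eq_preimage']
  congr 1
  ext ω
  simp only [Set.mem_preimage, Set.mem_inter_iff, Set.mem_union, Set.mem_compl_iff, mem_connEvent]
  exact ⟨fun h => ⟨h.1.1, h.2⟩, fun h => ⟨⟨h.1, conn_a2_a3_update_true he ω⟩, h.2⟩⟩

end TPin

/-! ## The forced-open Q-pair dominates the PD pair plus the T-pair -/

section Dominate
variable {V : Type*} {E : Type*} [Fintype E] [DecidableEq E]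
  {R : Type*} [CommRing R] [LinearOrder R] [IsStrictOrderedRing R]
variable {ends : E → Sym2 V} {a₁ a₂ a₃ : V} {e₂ : E}

omit [Fintype E] in
/-- `PD ∩ {o ∈ U}` and `T ∩ {o ∈ U}` (with `e₂` forced closed) both lie in `Q ∩ {o ∈ U}` with `e₂`
forced open. -/
lemma preimage_oU_update_true_superset (he : ends e₂ = s(a₂, a₃)) (o : V) :
    (fun ω : Config E => Function.update ω e₂ false) ⁻¹'
        (((connEvent ends a₁ o ∪ connEvent ends a₂ o) ∩ (connEvent ends a₁ a₃)ᶜ ∩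
            (connEvent ends a₂ a₃)ᶜ ∩ (connEvent ends a₁ a₂)ᶜ) ∪
          ((connEvent ends a₁ o ∪ connEvent ends a₂ o) ∩ connEvent ends a₂ a₃ ∩
            (connEvent ends a₁ a₂)ᶜ)) ⊆
      (fun ω : Config E => Function.update ω e₂ true) ⁻¹'
        ((connEvent ends a₁ o ∪ connEvent ends a₂ o) ∩ (connEvent ends a₁ a₂)ᶜ) := by
  intro ω hω
  simp only [Set.mem_preimage, Set.mem_union, Set.mem_inter_iff, Set.mem_compl_iff,
    mem_connEvent] at hω ⊢
  rcases hω with ⟨⟨⟨ho, h13⟩, _⟩, h12⟩ | ⟨⟨ho, _⟩, h12⟩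
  · refine ⟨?_, (not_conn_a1_a2_update_true_iff he ω).2 ⟨h12, h13⟩⟩
    rcases ho with h | h
    · exact Or.inl (conn_update_true_of_update_false ω h)
    · exact Or.inr (conn_update_true_of_update_false ω h)
  · have h13 : ¬ Conn ends (Function.update ω e₂ false) a₁ a₃ := fun h =>
      h12 (conn_trans h (conn_symm ‹Conn ends (Function.update ω e₂ false) a₂ a₃›))
    refine ⟨?_, (not_conn_a1_a2_update_true_iff he ω).2 ⟨h12, h13⟩⟩
    rcases ho with h | h
    · exact Or.inl (conn_update_true_of_update_false ω h)
    · exact Or.inr (conn_update_true_of_update_false ω h)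

/-- **The forced-open `o`-mass dominates**: `Dqo p₁ ≥ Dpdo p₀ + Dto p₀`. -/
theorem Dqo_update_one_ge (p : E → R) (hp : IsProbVec p) (he : ends e₂ = s(a₂, a₃)) (o : V) :
    Dpdo (Function.update p e₂ 0) ends o a₁ a₂ a₃ + Dto (Function.update p e₂ 0) ends o a₁ a₂ a₃ ≤
      Dqo (Function.update p e₂ 1) ends o a₁ a₂ := by
  have hsub := prob_mono hp (preimage_oU_update_true_superset (a₁ := a₁) he o)
  rw [← prob_update_one_eq_preimage', ← prob_update_zero_eq_preimage'] at hsub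
  have hdisj : Disjoint ((connEvent ends a₁ o ∪ connEvent ends a₂ o) ∩ (connEvent ends a₁ a₃)ᶜ ∩
      (connEvent ends a₂ a₃)ᶜ ∩ (connEvent ends a₁ a₂)ᶜ)
      ((connEvent ends a₁ o ∪ connEvent ends a₂ o) ∩ connEvent ends a₂ a₃ ∩
        (connEvent ends a₁ a₂)ᶜ) := by
    rw [Set.disjoint_left]
    rintro ω ⟨⟨⟨_, _⟩, h23⟩, _⟩ ⟨⟨_, h23'⟩, _⟩
    exact h23 h23'
  rw [prob_union_of_disjoint _ hdisj] at hsub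
  unfold Dpdo Dto Dqo
  exact hsub

end Dominate

/-! ## The T-odds lemma -/

section OddsT
variable {V : Type*} {E : Type*} [Fintype E] [DecidableEq E] [Fintype V] [DecidableEq V]
  {R : Type*} [Field R] [LinearOrder R] [IsStrictOrderedRing R]
variable {ends : E → Sym2 V} {a₁ a₂ a₃ : V}

/-- **The T-odds lemma**: `P(T, o ∈ U) · P(Q, a₃ ∈ C₁) ≥ P(T) · P(Q, a₃ ∈ C₁, o ∈ C₂)`, i.e.
`γ_T ≥ P(o ∈ C₂ ∣ Q, a₃ ∈ C₁)` — BHK 1.4 for `{a₃ ∈ C₁}`, `{o ∈ C₂}`, BHK 1.3 for `{o ∈ C₂}`,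
`{a₃ ∈ C₂}`, and `{o ∈ C₂} ⊆ {o ∈ U}`. -/
theorem odds_t (p : E → R) (hp : IsProbVec p) (o : V) :
    Dt p ends a₁ a₂ a₃ *
        prob p (connEvent ends a₁ a₃ ∩ connEvent ends a₂ o ∩ (connEvent ends a₁ a₂)ᶜ) ≤
      Dto p ends o a₁ a₂ a₃ * prob p (connEvent ends a₁ a₃ ∩ (connEvent ends a₁ a₂)ᶜ) := by
  unfold Dt Dto
  -- BHK 1.4: `P(Q) · P(Q, a₃ ∈ C₁, o ∈ C₂) ≤ P(Q, a₃ ∈ C₁) · P(Q, o ∈ C₂)`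
  have h14 := bhk_cross_cluster p hp ends a₁ a₂ (isUpperSet_mem_setOf a₃) (isUpperSet_mem_setOf o)
  rw [← connEvent_eq_clusterInEvent ends a₁ a₃, ← connEvent_eq_clusterInEvent ends a₂ o] at h14
  -- BHK 1.3: `P(Q, o ∈ C₂) · P(Q, a₃ ∈ C₂) ≤ P(Q, o ∈ C₂, a₃ ∈ C₂) · P(Q)`
  have h13 := bhk_same_cluster_events p hp ends a₂ a₁ (isUpperSet_mem_setOf o)
    (isUpperSet_mem_setOf a₃)
  rw [← connEvent_eq_clusterInEvent ends a₂ o, ← connEvent_eq_clusterInEvent ends a₂ a₃,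
    connEvent_comm ends a₂ a₁] at h13
  -- containment: `P(Q, o ∈ C₂, a₃ ∈ C₂) ≤ P(T, o ∈ U)`
  have hcont : prob p (connEvent ends a₂ o ∩ connEvent ends a₂ a₃ ∩ (connEvent ends a₁ a₂)ᶜ) ≤
      prob p ((connEvent ends a₁ o ∪ connEvent ends a₂ o) ∩ connEvent ends a₂ a₃ ∩
        (connEvent ends a₁ a₂)ᶜ) :=
    prob_mono hp (fun ω h => ⟨⟨Or.inr h.1.1, h.1.2⟩, h.2⟩)
  have hQ : 0 ≤ prob p (connEvent ends a₁ a₂)ᶜ := prob_nonneg hp _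
  have hA : 0 ≤ prob p (connEvent ends a₁ a₃ ∩ (connEvent ends a₁ a₂)ᶜ) := prob_nonneg hp _
  have hT : 0 ≤ prob p (connEvent ends a₂ a₃ ∩ (connEvent ends a₁ a₂)ᶜ) := prob_nonneg hp _
  have hAO : 0 ≤ prob p (connEvent ends a₁ a₃ ∩ connEvent ends a₂ o ∩ (connEvent ends a₁ a₂)ᶜ) :=
    prob_nonneg hp _
  have hO : 0 ≤ prob p (connEvent ends a₂ o ∩ (connEvent ends a₁ a₂)ᶜ) := prob_nonneg hp _
  rcases eq_or_lt_of_le hQ with hQ0 | hQpos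
  · -- `P(Q) = 0`: both sides vanish
    have hz : ∀ Y : Set (Config E), Y ⊆ (connEvent ends a₁ a₂)ᶜ → prob p Y = 0 := fun Y hY =>
      le_antisymm (by rw [hQ0]; exact prob_mono hp hY) (prob_nonneg hp Y)
    have z1 : prob p (connEvent ends a₂ a₃ ∩ (connEvent ends a₁ a₂)ᶜ) = 0 := hz _ (fun _ h => h.2)
    have z2 : prob p (connEvent ends a₁ a₃ ∩ connEvent ends a₂ o ∩ (connEvent ends a₁ a₂)ᶜ) = 0 :=
      hz _ (fun _ h => h.2)
    have z3 : prob p ((connEvent ends a₁ o ∪ connEvent ends a₂ o) ∩ connEvent ends a₂ a₃ ∩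
        (connEvent ends a₁ a₂)ᶜ) = 0 := hz _ (fun _ h => h.2)
    have z4 : prob p (connEvent ends a₁ a₃ ∩ (connEvent ends a₁ a₂)ᶜ) = 0 := hz _ (fun _ h => h.2)
    rw [z1, z2, z3, z4]
  · -- multiply the chain by `P(Q)` and cancel
    have key : prob p (connEvent ends a₁ a₂)ᶜ *
        (prob p (connEvent ends a₂ a₃ ∩ (connEvent ends a₁ a₂)ᶜ) *
          prob p (connEvent ends a₁ a₃ ∩ connEvent ends a₂ o ∩ (connEvent ends a₁ a₂)ᶜ)) ≤
        prob p (connEvent ends a₁ a₂)ᶜ *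
        (prob p ((connEvent ends a₁ o ∪ connEvent ends a₂ o) ∩ connEvent ends a₂ a₃ ∩
            (connEvent ends a₁ a₂)ᶜ) *
          prob p (connEvent ends a₁ a₃ ∩ (connEvent ends a₁ a₂)ᶜ)) := by
      calc prob p (connEvent ends a₁ a₂)ᶜ *
            (prob p (connEvent ends a₂ a₃ ∩ (connEvent ends a₁ a₂)ᶜ) *
              prob p (connEvent ends a₁ a₃ ∩ connEvent ends a₂ o ∩ (connEvent ends a₁ a₂)ᶜ))
          = (prob p (connEvent ends a₁ a₃ ∩ connEvent ends a₂ o ∩ (connEvent ends a₁ a₂)ᶜ) *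
              prob p (connEvent ends a₁ a₂)ᶜ) *
              prob p (connEvent ends a₂ a₃ ∩ (connEvent ends a₁ a₂)ᶜ) := by ring
        _ ≤ (prob p (connEvent ends a₁ a₃ ∩ (connEvent ends a₁ a₂)ᶜ) *
              prob p (connEvent ends a₂ o ∩ (connEvent ends a₁ a₂)ᶜ)) *
              prob p (connEvent ends a₂ a₃ ∩ (connEvent ends a₁ a₂)ᶜ) :=
            mul_le_mul_of_nonneg_right h14 hT
        _ = prob p (connEvent ends a₁ a₃ ∩ (connEvent ends a₁ a₂)ᶜ) *
              (prob p (connEvent ends a₂ o ∩ (connEvent ends a₁ a₂)ᶜ) *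
                prob p (connEvent ends a₂ a₃ ∩ (connEvent ends a₁ a₂)ᶜ)) := by ring
        _ ≤ prob p (connEvent ends a₁ a₃ ∩ (connEvent ends a₁ a₂)ᶜ) *
              (prob p (connEvent ends a₂ o ∩ connEvent ends a₂ a₃ ∩ (connEvent ends a₁ a₂)ᶜ) *
                prob p (connEvent ends a₁ a₂)ᶜ) :=
            mul_le_mul_of_nonneg_left h13 hA
        _ ≤ prob p (connEvent ends a₁ a₃ ∩ (connEvent ends a₁ a₂)ᶜ) *
              (prob p ((connEvent ends a₁ o ∪ connEvent ends a₂ o) ∩ connEvent ends a₂ a₃ ∩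
                  (connEvent ends a₁ a₂)ᶜ) * prob p (connEvent ends a₁ a₂)ᶜ) :=
            mul_le_mul_of_nonneg_left (mul_le_mul_of_nonneg_right hcont hQ) hA
        _ = prob p (connEvent ends a₁ a₂)ᶜ *
              (prob p ((connEvent ends a₁ o ∪ connEvent ends a₂ o) ∩ connEvent ends a₂ a₃ ∩
                  (connEvent ends a₁ a₂)ᶜ) *
                prob p (connEvent ends a₁ a₃ ∩ (connEvent ends a₁ a₂)ᶜ)) := by ring
    exact le_of_mul_le_mul_left key hQpos

end OddsT

end CaseOne

end Summit.Ventures.PercRepro2
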